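import Summits.ResolutionOfSingularities.ResolutionOfSingularities.Theorems.MarkedTransferCampaignW46ThreefoldsGammaFreeGlobalPatchingFinite
import Summits.ResolutionOfSingularities.ResolutionOfSingularities.Theorems.MarkedTransferCampaignW46ThreefoldsGammaFreeGlobalEtale
import Literature.AlgebraicGeometry.Resolution.NearPointsPointCentreUnique
import Literature.AlgebraicGeometry.Resolution.NearChainTermination
import Literature.AlgebraicGeometry.Resolution.IsolatedOrderPoint
import Literature.AlgebraicGeometry.Resolution.SubschemeRegularStalks
import Literature.AlgebraicGeometry.Resolution.PermissibleCentres
import Literature.AlgebraicGeometry.Resolution.BlowupOffCentre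
import Literature.AlgebraicGeometry.Resolution.BlowupsExistence
import Literature.AlgebraicGeometry.Resolution.RegularSystemOfParameters
import Literature.AlgebraicGeometry.Resolution.HilbertSamuelIsolatedSingularities
import HarnessLib

/-!
# [OURS · L1 W4.6 rung (ii-τ2)] THE ISOLATED `τ ≥ 2` SLICE AT d = 3 — an input whose order-`m` locus is a finite set of closed
# threefold points with Hironaka `τ ≥ 2` (and G-ring local rings) is order-reducible by POINT BLOW-UPS, PROVED

Cell res-hironaka, LADDER-RESOLUTION rung L (D-0089), slot W4.6, rung (ii) (threefold hypersurfaces) in the DIMENSION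
LADDER of the Γ-free statement (`CampaignW46.OrderReducible`, p496755). Seat res-L1-s46-pv-3 (gen 4). Host route
MarkedTransfer, host item `HypersurfaceOrderReductionDimLeThree` (stmt-ResolutionOfSingularities-16156); filed
`--supports` it `--as helper`. OURS scheme theory over PROVED tree lemmas: the kernel-checked near-point theory of
Cossart–Piltant 2008 §4 — Lemma 4.3 (1) `IsBlowup.stalkTau_le_two_of_isNear_point`, Lemma 4.3 (3)
`IsBlowup.stalkTau_le_stalkTau_of_isNear_point` / `IsBlowup.eq_of_isNear_of_isNear_point` (uniqueness of the near point, scheme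
level, p514195) — and the `τ = 2` TERMINATION THEOREM of the proof of Prop. 4.4, `false_of_nearChain_tau_two` (no infinite chain of
`τ = 2` near points over an isolated point of `Σ`, via Hironaka's formal axis and the G-ring transfer). Nothing of H. Hironaka's
manuscript is asserted. AI-written; AI review is weaker than expert review.

## What is proved (one proof-device structure, no OURS statement)

* `CampaignW46.OrderReducible.comap_opens_of_seq` — END GAME: a sequence of permissible blowing-ups of `X` whose last transform
  has order `< m` over an open `V ⊆ X` shows `(V, J|_V, m)` order-reducible (étale pull-back along `V ↪ X`, p500660).
* `CampaignW46.TauTwoChainState` — PROOF DEVICE (not an OURS notion): a stage of the point-blow-up chain over an isolated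
  `τ ≥ 2` point (`X_n`, `J_n`, the point `x_n`, the structure map to `X_0`, and the invariants: the points of order `≥ m` of
  `J_n` are `x_n` or lie over the complement of `V`; `ord_{x_n} J_n = m`, embedding dimension `3`, `τ(x_n) ≥ 2`).
* `CampaignW46.TauTwoChainState.exists_next` — THE STEP: if `(V, J_0|_V, m)` is NOT order-reducible, blowing up `x_n` produces
  a near point `x_{n+1}` over `x_n` (else the sequence so far reduces order over `V`), hence `τ(x_n) = 2` (Lemma 4.3 (1)); it is
  unique, closed, of order `m`, embedding dimension `3` and `τ ≥ 2` (Lemma 4.3 (3)) — a new stage.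
* `CampaignW46.orderReducible_comap_of_isolated_two_le_tau` — ONE BRANCH: `x_0 ∈ V` open, the points of order `≥ m` of `J` in
  `V` reduce to the closed point `x_0` (`ord = m`, emb. dim `3`, `τ ≥ 2`, `𝒪_{X,x_0}` a G-ring) ⟹ `OrderReducible (J|_V) m`:
  otherwise the steps never stop and give an infinite chain of `τ = 2` near points over the isolated point `x_0` of `Σ`,
  contradicting `false_of_nearChain_tau_two`.
* `CampaignW46.orderReducible_of_finite_two_le_tau` — **THE ISOLATED `τ ≥ 2` SLICE**: `X` regular locally Noetherian, `J`,
  `m ≥ 1`; if every point of order `≥ m` lies in a finite set `S` of closed points and at every `x ∈ S`: `ord_x J = m`, embedding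
  dimension `3`, `τ_x(J, m) ≥ 2`, and `𝒪_{X,x}` is a G-ring (e.g. `X` quasi-excellent), then `OrderReducible J m` (patching the
  branches, `OrderReducible.of_finite_of_forall_nhds` p508549). SUPERSEDES the `τ = 3` slice p509471 up to the G-ring hypothesis.
* `CampaignW46.gammaFreeGlobalDimLE_two_le_tau_slice` — the same in the binders of the ladder `GammaFreeGlobalOrderReductionDimLE
  p d` (any `d`).

HONEST VALUE. This is the whole `τ ≥ 2` branch of Cossart–Piltant's Prop. 4.4 for an ISOLATED order-`m` locus, characteristic-free,
as a kernel theorem about the campaign predicate: e.g. EVERY threefold hypersurface double point (`m = 2`) with `τ ≥ 2` isolated in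
`Sing(J, 2)` — `xy + z^k`-type (`A_{k-1}`), `x² + yz`, `xy + z²`, in every characteristic including `2` — is order-reduced by
successive point blow-ups, and the procedure provably STOPS. What it does NOT cover: points with `τ = 1` (there the polygon
/ (ω, κ)-invariants of CP2008–2019 are needed — the Moh–kangaroo phenomena live there), and positive-dimensional order-`m` loci.
The G-ring hypothesis is where quasi-excellence enters (formal axis ↔ algebraic branch).

References: tree `Resolution/NearChainTermination.lean` (`false_of_nearChain_tau_two` [CossartPiltant2008, proof of Prop. 4.4]),
`Resolution/NearPointsPointCentreUnique.lean` (p514195) and `NearPointsPointCentre.lean`, `NearPointTauMonotone.lean`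
[CossartPiltant2008, Lemma 4.3], `Resolution/IsolatedOrderPoint.lean` (`not_map_le_pow_of_isolated`), `Resolution/BlowupOffCentre.lean`,
`Resolution/BlowupsExistence.lean` (`exists_isBlowup` [GortzWedhorn2020, Prop. 13.92]), `Resolution/PermissibleCentres.lean`
(`stalkIdeal_vanishingIdeal_singleton`), `Resolution/ExcellentRings.lean` (`IsGRing` [Matsumura1987, §32]);
`…GammaFreeGlobalLadder.lean` (p496755), `…GammaFreeGlobalEtale.lean` (p500660), `…GammaFreeGlobalPatchingFinite.lean` (p508549).
H. Hironaka, ms. 2017-03-23 — scope only, under adjudication, not cited as fact. [Hironaka2017]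
-/

noncomputable section

set_option linter.dupNamespace false -- mandated namespace of this single-conjunct summit

open CategoryTheory AlgebraicGeometry TopologicalSpace IsLocalRing

namespace Summit.ResolutionOfSingularities.ResolutionOfSingularities.Theorems

namespace CampaignW46

open Literature.AlgebraicGeometry.Resolution
open Scheme.IdealSheafData

universe u

/-! ## §0 Plumbing: point equalities, point centres, the end game over an open -/

/-- Transport of the embedding dimension along an equality of points. [folklore] -/
theorem spanFinrank_maximalIdeal_congr {X : Scheme.{u}} {x y : X} (h : x = y) :
    (maximalIdeal (X.presheaf.stalk x)).spanFinrank = (maximalIdeal (X.presheaf.stalk y)).spanFinrank := by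
  subst h; rfl

/-- Transport of Hironaka's `τ` along an equality of points of a regular scheme. [folklore] -/
theorem stalkTau_congr {X : Scheme.{u}} (hX : Scheme.IsRegular X) (J : X.IdealSheafData) (μ : ℕ) {x y : X}
    (h : x = y) : (haveI := hX x; stalkTau J x μ) = (haveI := hX y; stalkTau J y μ) := by
  subst h; rfl

/-- Transport of the G-ring property of local rings along an equality of points. [folklore] -/
theorem isGRing_stalk_congr {X : Scheme.{u}} {x y : X} (h : x = y) (hG : IsGRing (X.presheaf.stalk x)) :
    IsGRing (X.presheaf.stalk y) := by
  subst h; exact hG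

/-- The reduced one-point subscheme on a closed point of a locally Noetherian scheme is regular (its local ring is the residue
field). [folklore] -/
theorem isRegular_subscheme_vanishingIdeal_singleton {X : Scheme.{u}} [IsLocallyNoetherian X] {x : X}
    (hx : IsClosed ({x} : Set X)) : Scheme.IsRegular (vanishingIdeal ⟨{x}, hx⟩).subscheme := by
  refine Scheme.isRegular_subscheme_of_forall _ fun y hy => ?_
  rw [← SetLike.mem_coe, coe_support_vanishingIdeal] at hy
  have hy' : y = x := hy
  subst hy'
  rw [stalkIdeal_vanishingIdeal_singleton hx]
  letI := Ideal.Quotient.field (maximalIdeal (X.presheaf.stalk y))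
  infer_instance

/-- A regular system of parameters of length `3` at a point of embedding dimension `3`, generating the stalk of the ideal of the
point. [folklore] -/
theorem exists_rsop_three {X : Scheme.{u}} {x : X} [IsRegularLocalRing (X.presheaf.stalk x)]
    (hx : IsClosed ({x} : Set X)) (hd : (maximalIdeal (X.presheaf.stalk x)).spanFinrank = 3) :
    ∃ c : Fin 3 → X.presheaf.stalk x, Ideal.span (Set.range c) = maximalIdeal _ ∧
      Ideal.span (Set.range c) = stalkIdeal (vanishingIdeal ⟨{x}, hx⟩) x := by
  obtain ⟨c₀, hc₀⟩ := exists_regularSystemOfParameters (R := X.presheaf.stalk x)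
  let c : Fin 3 → X.presheaf.stalk x := fun i => c₀ (i.cast hd.symm)
  have hrange : Set.range c = Set.range c₀ := by
    ext a
    constructor
    · rintro ⟨i, rfl⟩; exact ⟨i.cast hd.symm, rfl⟩
    · rintro ⟨i, rfl⟩; exact ⟨i.cast hd, by simp [c]⟩
  have hc : Ideal.span (Set.range c) = maximalIdeal _ := by rw [hrange, hc₀]
  exact ⟨c, hc, by rw [hc, stalkIdeal_vanishingIdeal_singleton hx]⟩

/-- **END GAME: order reduction OVER AN OPEN from a global sequence.** If `σ : Z ⟶ X` with last transform `J′` is a sequence of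
permissible blowing-ups for `(J, m)` (`X` locally Noetherian) and every point of `Z` of order `≥ m` maps OUTSIDE the open `V ⊆ X`,
then `(V, J|_V, m)` is order-reducible — by the pulled-back sequence over `V` (étale functoriality, p500660), whose last transform
has order `< m` everywhere. [cite: BierstoneGrigorievMilmanWlodarczyk2011, Thm. 8.0.5] -/
theorem OrderReducible.comap_opens_of_seq {X Z : Scheme.{u}} [IsLocallyNoetherian X] {J : X.IdealSheafData} {m : ℕ}
    {σ : Z ⟶ X} {J' : Z.IdealSheafData} (hseq : IsPermissibleBlowupSeq J m σ J') (V : X.Opens)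
    (h : ∀ z : Z, (m : ℕ∞) ≤ idealOrder J' z → σ z ∉ (V : Set X)) : OrderReducible (J.comap V.ι) m := by
  obtain ⟨Z', σ', ψ, hpb, hfl, hur, hft, hseq'⟩ := hseq.exists_isPullback_of_etale V.ι
  haveI := hfl
  haveI := hur
  haveI := hft
  refine ⟨Z', σ', J'.comap ψ, hseq', fun z => ?_⟩
  rw [idealOrder_comap_of_etale]
  by_contra hge
  rw [not_lt] at hge
  refine h (ψ z) hge ?_
  have hsq : σ (ψ z) = V.ι (σ' z) := by
    rw [← Scheme.Hom.comp_apply, ← Scheme.Hom.comp_apply, hpb.w]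
  rw [hsq, ← Scheme.Opens.range_ι V]
  exact ⟨_, rfl⟩

/-! ## §1 The chain state (proof device) -/

/-- PROOF DEVICE (not an OURS notion, no role of the manuscript): **a stage of the chain of point blow-ups over an isolated
`τ ≥ 2` point.** Over the fixed base `(X₀, J₀, m)` and open `V ⊆ X₀`: a scheme `X` (locally Noetherian, regular) with a
sequence of permissible blowing-ups `Φ : X ⟶ X₀` for `(J₀, m)` and last transform `J`, and a CLOSED point `x ∈ X` such that every
point of `X` of order `≥ m` is `x` or maps outside `V`; at `x`: `ord_x J = m`, embedding dimension `3`, `τ_x(J, m) ≥ 2`.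
[cite: CossartPiltant2008, proof of Prop. 4.4] -/
structure TauTwoChainState (X₀ : Scheme.{u}) (J₀ : X₀.IdealSheafData) (m : ℕ) (V : X₀.Opens) where
  /-- the stage `X_n` -/
  X : Scheme.{u}
  /-- the transform `J_n` -/
  J : X.IdealSheafData
  /-- the bad point `x_n` -/
  x : X
  /-- the structure morphism `X_n ⟶ X_0` -/
  Φ : X ⟶ X₀
  /-- `X_n` is locally Noetherian -/
  locNoeth : IsLocallyNoetherian X
  /-- `X_n` is regular -/
  reg : Scheme.IsRegular X
  /-- `Φ` is a sequence of permissible blowing-ups for `(J₀, m)` with last transform `J_n` -/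
  seq : IsPermissibleBlowupSeq J₀ m Φ J
  /-- `x_n` is a closed point -/
  closed : IsClosed ({x} : Set X)
  /-- the points of order `≥ m` are `x_n` or lie over the complement of `V` -/
  bad : ∀ z : X, (m : ℕ∞) ≤ idealOrder J z → z = x ∨ Φ z ∉ (V : Set X₀)
  /-- `ord_{x_n} J_n = m` -/
  ord : idealOrder J x = m
  /-- embedding dimension `3` at `x_n` -/
  dim : (maximalIdeal (X.presheaf.stalk x)).spanFinrank = 3
  /-- `τ(x_n) ≥ 2` -/
  tau : haveI := reg x; 2 ≤ stalkTau J x m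

namespace TauTwoChainState

variable {X₀ : Scheme.{u}} [IsLocallyNoetherian X₀] {J₀ : X₀.IdealSheafData} {m : ℕ} {V : X₀.Opens}

set_option maxHeartbeats 800000 in
-- one long assembly of the near-point theory at the new stage
/-- **THE STEP.** `X₀` regular locally Noetherian, `m ≥ 1`, and `(V, J₀|_V, m)` NOT order-reducible. For a stage `σ`, let
`π : X′ ⟶ X_n` be the blowing up of the closed point `x_n` and `J′` the controlled transform. Then some point `x′ ∈ X′` over
`x_n` is near (otherwise every point of `X′` of order `≥ m` maps outside `V` and the sequence so far reduces order over `V`), so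
`τ(x_n) = 2` (CP2008 Lemma 4.3 (1)); the near point is unique, closed, of order `m`, embedding dimension `3` and `τ ≥ 2`
(Lemma 4.3 (3)); and `(X′, J′, x′)` is a new stage. [cite: CossartPiltant2008, Lemma 4.3; proof of Prop. 4.4] -/
theorem exists_next (hX₀ : Scheme.IsRegular X₀) (hm : 1 ≤ m) (hnot : ¬ OrderReducible (J₀.comap V.ι) m)
    (σ : TauTwoChainState X₀ J₀ m V) :
    ∃ (σ' : TauTwoChainState X₀ J₀ m V) (π : σ'.X ⟶ σ.X),
      IsBlowup π (vanishingIdeal ⟨{σ.x}, σ.closed⟩) ∧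
      σ'.J = controlledTransform π (vanishingIdeal ⟨{σ.x}, σ.closed⟩) σ.J m ∧
      π σ'.x = σ.x ∧ IsNear π (vanishingIdeal ⟨{σ.x}, σ.closed⟩) σ.J m σ'.x ∧
      (haveI := σ.reg σ.x; stalkTau σ.J σ.x m = 2) := by
  classical
  haveI : IsLocallyNoetherian σ.X := σ.locNoeth
  have hX : Scheme.IsRegular σ.X := σ.reg
  set D : Closeds σ.X := ⟨{σ.x}, σ.closed⟩ with hDdef
  have hreg : Scheme.IsRegular (vanishingIdeal D).subscheme := isRegular_subscheme_vanishingIdeal_singleton σ.closed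
  have hY : ∀ y ∈ (D : Set σ.X), idealOrder σ.J y = m := fun y hy => by
    have hy' : y = σ.x := hy
    rw [hy']; exact σ.ord
  have hD : ∀ y ∈ (D : Set σ.X), (m : ℕ∞) ≤ idealOrder σ.J y := fun y hy => (hY y hy).ge
  -- the blowing up of the point and the next stage of the sequence
  obtain ⟨X', π, hπ⟩ := exists_isBlowup σ.X (vanishingIdeal D)
  have hseq' : IsPermissibleBlowupSeq J₀ m (π ≫ σ.Φ) (controlledTransform π (vanishingIdeal D) σ.J m) :=
    σ.seq.blowup D π hreg hD hπ
  obtain ⟨hN', hR'⟩ := hseq'.isLocallyNoetherian_and_isRegular inferInstance hX₀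
  haveI := hN'
  set J' := controlledTransform π (vanishingIdeal D) σ.J m with hJ'def
  -- the points of `X'` of order `≥ m` off the fibre of `x_n` map outside `V`
  have hoff : ∀ z : X', π z ≠ σ.x → (m : ℕ∞) ≤ idealOrder J' z → (π ≫ σ.Φ) z ∉ (V : Set X₀) := by
    intro z hπz hz
    have hz' : π z ∉ ((vanishingIdeal D).support : Set σ.X) := by
      rw [coe_support_vanishingIdeal]; exact hπz
    rw [hJ'def, hπ.idealOrder_controlledTransform_of_not_mem σ.J m hz'] at hz
    rcases σ.bad (π z) hz with h | h
    · exact absurd h hπz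
    · rwa [Scheme.Hom.comp_apply]
  -- points over `x_n` of order `≥ m` are near
  have hnear_of : ∀ z : X', π z = σ.x → (m : ℕ∞) ≤ idealOrder J' z → IsNear π (vanishingIdeal D) σ.J m z := by
    intro z hπz hz
    have hle := hπ.idealOrder_controlledTransform_le_of_mem hX hreg hY (x' := z) (by rw [hπz]; rfl)
    exact isNear_iff.mpr (le_antisymm hle hz)
  -- a near point exists, or the sequence so far reduces order over `V`
  have hex : ∃ x' : X', π x' = σ.x ∧ IsNear π (vanishingIdeal D) σ.J m x' := by
    by_contra hne
    push Not at hne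
    refine hnot (OrderReducible.comap_opens_of_seq hseq' V fun z hz => ?_)
    by_cases hπz : π z = σ.x
    · exact absurd (hnear_of z hπz hz) (hne z hπz)
    · exact hoff z hπz hz
  obtain ⟨x', hx', hnear⟩ := hex
  -- the data at `x_n`, read at the point `π x'`
  haveI : IsRegularLocalRing (σ.X.presheaf.stalk (π x')) := hX (π x')
  haveI : IsRegularLocalRing (X'.presheaf.stalk x') := hR' x'
  have hcl : IsClosed ({π x'} : Set σ.X) := by rw [hx']; exact σ.closed
  have hDeq : D = ⟨{π x'}, hcl⟩ := Closeds.ext (by rw [hDdef]; simp [hx'])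
  have hd : (maximalIdeal (σ.X.presheaf.stalk (π x'))).spanFinrank = 3 := by
    rw [spanFinrank_maximalIdeal_congr hx']; exact σ.dim
  obtain ⟨c, hc, hcY⟩ := exists_rsop_three hcl hd
  rw [← hDeq] at hcY
  have hτ2 : 2 ≤ stalkTau σ.J (π x') m := by
    have h := σ.tau
    rwa [← stalkTau_congr hX σ.J m hx'] at h
  have hτ : stalkTau σ.J (π x') m = 2 :=
    le_antisymm (hπ.stalkTau_le_two_of_isNear_point hd hc hcY hnear) hτ2
  -- the invariants at the near point
  have hclosed' : IsClosed ({x'} : Set X') :=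
    hπ.isClosed_singleton_of_isNear_point hX hR' hreg hY hcl hd hc hcY hτ hnear
  have hdim' : (maximalIdeal (X'.presheaf.stalk x')).spanFinrank = 3 :=
    hπ.spanFinrank_eq_three_of_isNear_point hd hc hcY hτ hnear
  have htau' : 2 ≤ stalkTau J' x' m := by
    have h := hπ.stalkTau_le_stalkTau_of_isNear_point hm hd hc hcY hτ hnear
    rwa [hτ] at h
  have hbad' : ∀ z : X', (m : ℕ∞) ≤ idealOrder J' z → z = x' ∨ (π ≫ σ.Φ) z ∉ (V : Set X₀) := by
    intro z hz
    by_cases hπz : π z = σ.x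
    · left
      have hnz := hnear_of z hπz hz
      exact hπ.eq_of_isNear_of_isNear_point hd hc hcY hτ hnear hnz (hπz.trans hx'.symm)
    · exact Or.inr (hoff z hπz hz)
  refine ⟨⟨X', J', x', π ≫ σ.Φ, hN', hR', hseq', hclosed', hbad', isNear_iff.mp hnear, hdim', htau'⟩, π, hπ, rfl,
    hx', hnear, ?_⟩
  rw [stalkTau_congr hX σ.J m hx'.symm]; exact hτ

end TauTwoChainState

/-! ## §2 One branch: an isolated `τ ≥ 2` point -/

set_option maxHeartbeats 800000 in
-- the chain hypotheses of `false_of_nearChain_tau_two` are many; each is a transport along `π_n x_{n+1} = x_n`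
/-- **ONE BRANCH.** `X` regular locally Noetherian, `J`, `m ≥ 1`, `V ⊆ X` open, `x ∈ V` a closed point such that every point of
order `≥ m` of `J` is `x` or lies outside `V`, with `ord_x J = m`, embedding dimension `3`, `τ_x(J, m) ≥ 2` and `𝒪_{X,x}` a G-ring.
Then `(V, J|_V, m)` is ORDER-REDUCIBLE. Proof: otherwise `TauTwoChainState.exists_next` never stops and yields an infinite chain
of `τ = 2` near points under successive point blow-ups over `x`, which is an ISOLATED point of `Σ = {ord ≥ m}` (its generizations
lie in `V`); this contradicts the tree's `false_of_nearChain_tau_two` (Cossart–Piltant 2008, proof of Prop. 4.4: the formal axis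
of the chain gives a formal branch of `Σ` through `x`; G-ring transfer). [cite: CossartPiltant2008, proof of Prop. 4.4] -/
theorem orderReducible_comap_of_isolated_two_le_tau {X : Scheme.{u}} [IsLocallyNoetherian X] (hX : Scheme.IsRegular X)
    (J : X.IdealSheafData) {m : ℕ} (hm : 1 ≤ m) (V : X.Opens) (x : X) (hxV : x ∈ V)
    (hcl : IsClosed ({x} : Set X)) (hbad : ∀ z : X, (m : ℕ∞) ≤ idealOrder J z → z = x ∨ z ∉ (V : Set X))
    (hord : idealOrder J x = m) (hdim : (maximalIdeal (X.presheaf.stalk x)).spanFinrank = 3)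
    (hτ : haveI := hX x; 2 ≤ stalkTau J x m) (hG : IsGRing (X.presheaf.stalk x)) :
    OrderReducible (J.comap V.ι) m := by
  classical
  by_contra hnot
  -- the initial stage
  let σ₀ : TauTwoChainState X J m V :=
    ⟨X, J, x, 𝟙 X, inferInstance, hX, IsPermissibleBlowupSeq.nil, hcl,
      fun z hz => (hbad z hz).imp id fun h => by simpa using h, hord, hdim, hτ⟩
  -- the chain
  choose next πn hπn hJn hxn hnearn hτn using TauTwoChainState.exists_next (V := V) hX hm hnot
  let chain : ℕ → TauTwoChainState X J m V := fun n => Nat.rec σ₀ (fun _ σ => next σ) n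
  have chain_succ : ∀ n, chain (n + 1) = next (chain n) := fun n => rfl
  let Xs : ℕ → Scheme.{u} := fun n => (chain n).X
  let π : ∀ n, Xs (n + 1) ⟶ Xs n := fun n => πn (chain n)
  let y : ∀ n, Xs (n + 1) := fun n => (chain (n + 1)).x
  let Js : ∀ n, (Xs n).IdealSheafData := fun n => (chain n).J
  haveI : ∀ n, IsLocallyNoetherian (Xs n) := fun n => (chain n).locNoeth
  have e : ∀ n, π n (y n) = (chain n).x := fun n => hxn (chain n)
  have hy : ∀ n, π (n + 1) (y (n + 1)) = y n := fun n => e (n + 1)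
  have hcls : ∀ n, IsClosed ({π n (y n)} : Set (Xs n)) := fun n => by rw [e n]; exact (chain n).closed
  have hC : ∀ n, (⟨{π n (y n)}, hcls n⟩ : Closeds (Xs n)) = ⟨{(chain n).x}, (chain n).closed⟩ := fun n =>
    Closeds.ext (by simp [e n])
  have hregb : ∀ n, IsRegularLocalRing ((Xs n).presheaf.stalk (π n (y n))) := fun n => (chain n).reg _
  have hreg : ∀ n, IsRegularLocalRing ((Xs (n + 1)).presheaf.stalk (y n)) := fun n => (chain (n + 1)).reg _
  refine false_of_nearChain_tau_two Xs π y Js hm hy hcls (fun n => ?_) hregb hreg (fun n => ?_) (fun n => ?_)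
    (fun n => ?_) (fun n => ?_) (fun n => ?_) ?_ ?_ ?_
  · -- the blowing up of the point
    rw [hC n]; exact hπn (chain n)
  · -- embedding dimension `3`
    rw [spanFinrank_maximalIdeal_congr (e n)]; exact (chain n).dim
  · -- the controlled transform
    rw [hC n]; exact hJn (chain n)
  · -- nearness
    rw [hC n]; exact hnearn (chain n)
  · -- `τ(x_n) = 2`
    have h := hτn (chain n)
    rw [← stalkTau_congr (chain n).reg (chain n).J m (e n)] at h
    exact h
  · -- `τ(x_{n+1}) = 2`, read at `y_n = x_{n+1}`
    exact hτn (chain (n + 1))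
  · -- `ord_{x_0} J_0 ≥ m`
    rw [← le_idealOrder_iff]
    have h0 : idealOrder (Js 0) ((chain 0).x) = m := hord
    rw [e 0, h0]
  · -- `𝒪_{X,x_0}` is a G-ring
    exact isGRing_stalk_congr (e 0).symm hG
  · -- `x_0` is isolated in `Σ`: generizations of `x` lie in the open `V`
    intro 𝔮 _ h𝔮
    refine not_map_le_pow_of_isolated (Js 0) (π 0 (y 0)) m (fun ζ hζ hne hle => ?_) 𝔮 h𝔮
    rw [e 0] at hζ hne
    have hζ' : ζ ⤳ x := hζ
    rcases hbad ζ hle with h | h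
    · exact hne h
    · exact h (hζ'.mem_open V.2 hxV)

/-! ## §3 The isolated `τ ≥ 2` slice -/

/-- **THE ISOLATED `τ ≥ 2` SLICE.** `X` regular locally Noetherian, `J` an ideal sheaf, `m ≥ 1`. Suppose every point of `X` of
order `≥ m` lies in a finite set `S` of closed points, and at every `x ∈ S`: `ord_x J = m`, the embedding dimension of `𝒪_{X,x}`
is `3`, Hironaka's `τ_x(J, m) ≥ 2`, and `𝒪_{X,x}` is a G-ring. Then `(X, J, m)` is ORDER-REDUCIBLE by permissible blowing-ups
(indeed by successive blowing-ups of closed points): order-reducibility is pointwise-local for a finite bad locus (p508549), and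
each branch is `orderReducible_comap_of_isolated_two_le_tau` on `V = X ∖ (S ∖ {x})`.
[cite: CossartPiltant2008, Prop. 4.4 (proof, cases τ = 2, 3)] -/
theorem orderReducible_of_finite_two_le_tau {X : Scheme.{u}} [IsLocallyNoetherian X] (hX : Scheme.IsRegular X)
    (J : X.IdealSheafData) {m : ℕ} (hm : 1 ≤ m) (S : Set X) (hS : S.Finite) (hSc : ∀ x ∈ S, IsClosed ({x} : Set X))
    (hJS : ∀ x : X, (m : ℕ∞) ≤ idealOrder J x → x ∈ S) (hord : ∀ x ∈ S, idealOrder J x = m)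
    (hdim : ∀ x ∈ S, (maximalIdeal (X.presheaf.stalk x)).spanFinrank = 3)
    (hτ : ∀ x ∈ S, haveI := hX x; 2 ≤ stalkTau J x m) (hG : ∀ x ∈ S, IsGRing (X.presheaf.stalk x)) :
    OrderReducible J m := by
  refine OrderReducible.of_finite_of_forall_nhds hX J S hS hSc hJS fun x hx => ?_
  -- the open `V = X ∖ (S ∖ {x})` isolates the branch of `x`
  have hcl : IsClosed (S \ {x}) :=
    isClosed_of_finite_of_isClosed_singleton (hS.subset Set.sdiff_subset) fun y hy => hSc y hy.1
  let V : X.Opens := ⟨(S \ {x})ᶜ, hcl.isOpen_compl⟩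
  have hxV : x ∈ V := fun h => h.2 rfl
  refine ⟨V, hxV, orderReducible_comap_of_isolated_two_le_tau hX J hm V x hxV (hSc x hx) (fun z hz => ?_)
    (hord x hx) (hdim x hx) (hτ x hx) (hG x hx)⟩
  by_cases hzx : z = x
  · exact Or.inl hzx
  · exact Or.inr fun h => h ⟨hJS z hz, hzx⟩

/-- The `τ ≥ 2` slice CONTAINS the maximal-`τ` slice (p509471) once the local rings at the bad points are G-rings: `τ = 3 ⇒ τ ≥ 2`.
[cite: CossartPiltant2008, Prop. 4.4] -/
theorem orderReducible_of_finite_tau_eq_three_of_isGRing {X : Scheme.{u}} [IsLocallyNoetherian X]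
    (hX : Scheme.IsRegular X) (J : X.IdealSheafData) {m : ℕ} (hm : 1 ≤ m) (S : Set X) (hS : S.Finite)
    (hSc : ∀ x ∈ S, IsClosed ({x} : Set X)) (hJS : ∀ x : X, (m : ℕ∞) ≤ idealOrder J x → x ∈ S)
    (hord : ∀ x ∈ S, idealOrder J x = m) (hdim : ∀ x ∈ S, (maximalIdeal (X.presheaf.stalk x)).spanFinrank = 3)
    (hτ : ∀ x ∈ S, haveI := hX x; stalkTau J x m = 3) (hG : ∀ x ∈ S, IsGRing (X.presheaf.stalk x)) :
    OrderReducible J m :=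
  orderReducible_of_finite_two_le_tau hX J hm S hS hSc hJS hord hdim (fun x hx => by rw [hτ x hx]; norm_num) hG

/-! ## §4 In the ladder's binders -/

/-- **THE ISOLATED `τ ≥ 2` SLICE OF EVERY RUNG OF THE Γ-FREE LADDER** (`GammaFreeGlobalOrderReductionDimLE p d`, p496755): its
binders, plus «the points of order `≥ m` form a finite set of closed points, each of order exactly `m`, embedding dimension `3`,
`τ ≥ 2`, with G-ring local rings», give `OrderReducible I m` — at every `d`, in particular for the statement of record `d = 3`.
Only local Noetherianity and regularity of `X` are used. [cite: CossartPiltant2008, Prop. 4.4] -/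
theorem gammaFreeGlobalDimLE_two_le_tau_slice (p d : ℕ) :
    p.Prime → ∀ (k : Type u) [Field k] [CharP k p] [PerfectField k] (X : Scheme.{u}) (s : X ⟶ Spec (.of k)),
      IsSeparated s → LocallyOfFiniteType s → QuasiCompact s → IsIntegral X → ∀ (hreg : Scheme.IsRegular X),
        topologicalKrullDim X ≤ d → ∀ (I : X.IdealSheafData), I ≠ ⊥ → IsEffectiveCartier I → ∀ (m : ℕ), 1 ≤ m →
          ∀ (S : Set X), S.Finite → (∀ x ∈ S, IsClosed ({x} : Set X)) →
            (∀ x : X, (m : ℕ∞) ≤ idealOrder I x → x ∈ S) → (∀ x ∈ S, idealOrder I x = m) →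
              (∀ x ∈ S, (maximalIdeal (X.presheaf.stalk x)).spanFinrank = 3) →
                (∀ x ∈ S, haveI := hreg x; 2 ≤ stalkTau I x m) → (∀ x ∈ S, IsGRing (X.presheaf.stalk x)) →
                  OrderReducible I m := by
  intro _ k _ _ _ X s _ hloft _ _ hreg _ I _ _ m hm S hS hSc hJS hord hdim hτ hG
  haveI : IsLocallyNoetherian X := LocallyOfFiniteType.isLocallyNoetherian s
  exact orderReducible_of_finite_two_le_tau hreg I hm S hS hSc hJS hord hdim hτ hG

end CampaignW46

end Summit.ResolutionOfSingularities.ResolutionOfSingularities.Theorems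

end
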